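import Mathlib
import HarnessLib

/-!
# Eigen-coordinates of a tame-centre blow-up: quotient characters upstairs, and inert points sit in ONE isotypic block
# (crux `WildQuotients.WildQuotientResolution`, stub `stub_phaseZeroHighDim`; cotangent dynamics of the tame move, any dimension)

Crux stmt-ResolutionOfSingularities-15640 (`WildQuotientResolution`), registered stub `stub_phaseZeroHighDim`.
✓`InertLocusStalk.tameMove` (p819797) blows up the reduced inert locus `Z_K` of a tame normal subgroup `K` in
every dimension; what it does to the inertia groups OVER `Z_K` is the termination question (evidence memo
PHASE0-TAME-CENTRE-ORDER.md on the item: the order of the centres matters). This Mathlib-only file is the local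
algebra of that question ("R-A" of hand 6 g1), in the abstract one-step setting of ✓`FlagStep.hasNormalSylow_of_blowupStep`:
`ι : (R, 𝔪) → (S, 𝔫)` the injective local homomorphism of a blow-up chart at a point `x` over `z`, `S` a local
domain, the centre `J` becoming principal upstairs, `J S = ι(t) S`, so that every `r ∈ J` has a RATIO
`e_r ∈ S`, `ι r = e_r · ι t`; an element `k` of the stabiliser acting by `τ` on `R` and `τ₁` on `S`, compatibly.
For a TAME `k` the centre `J = 𝔞_K` has EIGEN-generators (`|K|` invertible: isotypic decomposition), `τ r = u·r`,
`τ t = v·t` with `u, v` units whose residues are the characters `χ_r(k), χ_t(k)`. Then: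

* `apply_ratio_mul_eq` — `τ₁(e_r) · e_{τ t} = ι(u) · e_r`; with `τ t = v t`: `e_{τ t} = ι v` (`ratio_of_apply_eq_mul`)
  and **`τ₁(e_r) = ι(u v⁻¹) · e_r`** (`apply_ratio_eq_mul`): the ratio `r/t` is an EXACT eigenvector upstairs with
  the QUOTIENT character `χ_r χ_t⁻¹`; the equation `ι t` of the exceptional divisor is an eigenvector with character
  `χ_t` (`apply_map_eq_mul`) — a boundary LINE of the flag of ✓`TameEndState` (p817841/p819336).
* `sub_mem_maximalIdeal_of_residueTrivial_of_isUnit_ratio` — **inert points concentrate in one isotypic block**: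
  if `k` is in the INERTIA group at `x` (`τ₁` residue-trivial) and the ratio `e_r` is a UNIT at `x` (the point is
  off the strict transform of `V(r)`), then `ι u − ι v ∈ 𝔫`, i.e. `χ_r(k) = χ_t(k)`; pulled back along the local `ι`,
  `u − v ∈ 𝔪` (`sub_mem_maximalIdeal_of_residueTrivial_of_isUnit_ratio'`). Contrapositive
  (`ratio_mem_maximalIdeal_of_residueTrivial`): at a `k`-inert point every eigen-generator with a character
  DIFFERENT from `χ_t(k)` has its ratio in `𝔫` — geometrically, the `K`-inert locus of the blow-up meets the fibre
  `ℙ(J/𝔪J)` over `z` only inside the projectivised isotypic blocks `ℙ((J/𝔪J)_χ)`, and at such a point the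
  non-boundary characters of `k` on the new cotangent space are the quotients `χ' χ⁻¹`, `χ' ≠ χ` (their number drops
  from `c = Σ c_χ'` to `c − c_χ`: the bookkeeping a termination proof of the tame layer would run on).

[OURS · crux stmt-ResolutionOfSingularities-15640 · helper toward `stub_phaseZeroHighDim` (cotangent dynamics of the
tame move; NOT a proof of the stub); folklore local algebra, counted 0; AI-level work, weaker than expert review.]
[folklore]
-/

-- single-problem summit: the doubled namespace component `ResolutionOfSingularities` is forced
set_option linter.dupNamespace false

namespace Summit.ResolutionOfSingularities.ResolutionOfSingularities.Theorems.WildQuotientResolution.TameMoveEigen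

open IsLocalRing

variable {R S : Type*} [CommRing R] [CommRing S] [IsDomain S] (ι : R →+* S)

/-! ## Ratios along the exceptional equation -/

/-- The ratio is unique: `ι r = e · ι t = e' · ι t` with `ι t ≠ 0` forces `e = e'`. [folklore] -/
theorem ratio_unique {t : R} (ht : ι t ≠ 0) {r : R} {e e' : S} (he : ι r = e * ι t)
    (he' : ι r = e' * ι t) : e = e' :=
  mul_right_cancel₀ ht (he.symm.trans he')

/-- If `τ t = v · t` then the ratio of `τ t` is `ι v`. [folklore] -/
theorem ratio_of_apply_eq_mul {t : R} (ht : ι t ≠ 0) (τ : R ≃+* R) {v : R} (hv : τ t = v * t)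
    {eₜ : S} (het : ι (τ t) = eₜ * ι t) : eₜ = ι v :=
  ratio_unique ι ht het (by rw [hv, map_mul])

/-- **Quotient characters upstairs, product form**: for `τ r = u · r` (`r ∈ J` an eigen-generator), the ratios
`e_r` of `r` and `e_{τ t}` of `τ t` satisfy `τ₁(e_r) · e_{τ t} = ι(u) · e_r`. [folklore] -/
theorem apply_ratio_mul_eq {t : R} (ht : ι t ≠ 0) (τ : R ≃+* R) (τ₁ : S ≃+* S)
    (hcomp : ∀ r, ι (τ r) = τ₁ (ι r)) {r : R} {e eₜ : S} (he : ι r = e * ι t)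
    (het : ι (τ t) = eₜ * ι t) {u : R} (hu : τ r = u * r) : τ₁ e * eₜ = ι u * e := by
  apply mul_right_cancel₀ ht
  have h1 : ι (τ r) = τ₁ e * eₜ * ι t := by
    rw [hcomp, he, map_mul, ← hcomp, het, mul_assoc]
  have h2 : ι (τ r) = ι u * e * ι t := by
    rw [hu, map_mul, he, mul_assoc]
  rw [← h1, ← h2]

/-- **Quotient characters upstairs**: if `τ r = u · r` and `τ t = v · t` with `v` a unit, then the ratio
`e_r = r/t` is an EXACT eigenvector of `τ₁` with eigenvalue `ι(u · v⁻¹)`: `τ₁(e_r) = ι(u v⁻¹) · e_r`. [folklore] -/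
theorem apply_ratio_eq_mul {t : R} (ht : ι t ≠ 0) (τ : R ≃+* R) (τ₁ : S ≃+* S)
    (hcomp : ∀ r, ι (τ r) = τ₁ (ι r)) {r : R} {e : S} (he : ι r = e * ι t)
    {u : R} (hu : τ r = u * r) {v : Rˣ} (hv : τ t = v * t) :
    τ₁ e = ι (u * ↑v⁻¹) * e := by
  have het : ι (τ t) = ι v * ι t := by rw [hv, map_mul]
  have h := apply_ratio_mul_eq ι ht τ τ₁ hcomp he het hu
  have hvu : IsUnit (ι (v : R)) := (Units.isUnit v).map ι
  calc τ₁ e = τ₁ e * ι (v : R) * ι (↑v⁻¹ : R) := by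
          rw [mul_assoc, ← map_mul, Units.mul_inv, map_one, mul_one]
    _ = ι u * e * ι (↑v⁻¹ : R) := by rw [h]
    _ = ι (u * ↑v⁻¹) * e := by rw [map_mul]; ring

omit [IsDomain S] in
/-- The equation `ι t` of the exceptional divisor is an eigenvector of `τ₁` with eigenvalue `ι v` (the character
`χ_t` on the conormal line of the boundary divisor). [folklore] -/
theorem apply_map_eq_mul (τ : R ≃+* R) (τ₁ : S ≃+* S) (hcomp : ∀ r, ι (τ r) = τ₁ (ι r)) {t v : R}
    (hv : τ t = v * t) : τ₁ (ι t) = ι v * ι t := by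
  rw [← hcomp, hv, map_mul]

/-! ## Inert points sit in one isotypic block -/

variable [IsLocalRing S]

/-- **At an inert point the visible characters agree with `χ_t`**: if `τ₁` is residue-trivial (`k` lies in the
inertia group at `x`), `τ r = u · r`, `τ t = v · t`, and the ratio `e_r` is a UNIT of `S` (the point is off the
strict transform of `V(r)`), then `ι u − ι v ∈ 𝔫`: the characters of `r` and `t` agree at `x`. [folklore] -/
theorem sub_mem_maximalIdeal_of_residueTrivial_of_isUnit_ratio {t : R} (ht : ι t ≠ 0) (τ : R ≃+* R)
    (τ₁ : S ≃+* S) (hcomp : ∀ r, ι (τ r) = τ₁ (ι r)) (hres : ∀ s, τ₁ s - s ∈ maximalIdeal S)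
    {r : R} {e : S} (he : ι r = e * ι t) (heu : IsUnit e) {u v : R} (hu : τ r = u * r)
    (hv : τ t = v * t) : ι u - ι v ∈ maximalIdeal S := by
  have het : ι (τ t) = ι v * ι t := by rw [hv, map_mul]
  have h := apply_ratio_mul_eq ι ht τ τ₁ hcomp he het hu
  -- `τ₁ e = e + m`, `m ∈ 𝔫`; so `e (ι v - ι u) = -(m ι v) ∈ 𝔫`, and `e` is a unit
  have hm : τ₁ e - e ∈ maximalIdeal S := hres e
  have hkey : e * (ι u - ι v) = (τ₁ e - e) * ι v := by
    have := h
    linear_combination -this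
  have hmem : e * (ι u - ι v) ∈ maximalIdeal S := by
    rw [hkey]
    exact Ideal.mul_mem_right _ _ hm
  exact (Ideal.unit_mul_mem_iff_mem _ heu).mp hmem

/-- The same pulled back to `R` along the LOCAL homomorphism `ι`: `u − v ∈ 𝔪`, i.e. `χ_r(k) = χ_t(k)` in the
residue field of `z`. [folklore] -/
theorem sub_mem_maximalIdeal_of_residueTrivial_of_isUnit_ratio' [IsLocalRing R] [IsLocalHom ι] {t : R}
    (ht : ι t ≠ 0) (τ : R ≃+* R) (τ₁ : S ≃+* S) (hcomp : ∀ r, ι (τ r) = τ₁ (ι r))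
    (hres : ∀ s, τ₁ s - s ∈ maximalIdeal S) {r : R} {e : S} (he : ι r = e * ι t) (heu : IsUnit e)
    {u v : R} (hu : τ r = u * r) (hv : τ t = v * t) : u - v ∈ maximalIdeal R := by
  have h := sub_mem_maximalIdeal_of_residueTrivial_of_isUnit_ratio ι ht τ τ₁ hcomp hres he heu hu hv
  rw [← map_sub] at h
  rw [mem_maximalIdeal, mem_nonunits_iff] at h ⊢
  exact fun hu' => h (hu'.map ι)

/-- **Contrapositive: off-block eigen-generators vanish at inert points.** If `τ₁` is residue-trivial,
`τ r = u · r`, `τ t = v · t` and the characters DIFFER at `z` (`u − v ∉ 𝔪`, i.e. `u − v` is a unit of `R`), then the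
ratio `e_r` lies in `𝔫`: a `k`-inert point over `z` lies on the strict transform of `V(r)` for every
eigen-generator `r` of a character different from `χ_t(k)` — the `K`-inert locus upstairs meets the fibre only in
the projectivised isotypic blocks. [folklore] -/
theorem ratio_mem_maximalIdeal_of_residueTrivial [IsLocalRing R] [IsLocalHom ι] {t : R} (ht : ι t ≠ 0)
    (τ : R ≃+* R) (τ₁ : S ≃+* S) (hcomp : ∀ r, ι (τ r) = τ₁ (ι r))
    (hres : ∀ s, τ₁ s - s ∈ maximalIdeal S) {r : R} {e : S} (he : ι r = e * ι t) {u v : R}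
    (hu : τ r = u * r) (hv : τ t = v * t) (huv : IsUnit (u - v)) : e ∈ maximalIdeal S := by
  by_contra hne
  have heu : IsUnit e := by
    rw [mem_maximalIdeal, mem_nonunits_iff, not_not] at hne
    exact hne
  have h := sub_mem_maximalIdeal_of_residueTrivial_of_isUnit_ratio' ι ht τ τ₁ hcomp hres he heu hu hv
  exact (mem_maximalIdeal _).mp h |> fun h' => h' huv

omit [IsLocalRing S] in
/-- **Off-block ratios are moved to first order by a unit factor**: if `τ r = u · r`, `τ t = v · t` (`v` a unit)
and `u − v` is a unit of `R`, then `τ₁(e_r) − e_r = w · e_r` with `w = ι(u v⁻¹) − 1` a UNIT of `S`: on the line of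
the new cotangent space spanned by an off-block ratio, `k` acts through the non-trivial character `χ_r χ_t⁻¹` —
these are the non-boundary characters that survive the move. [folklore] -/
theorem apply_ratio_sub_eq {t : R} (ht : ι t ≠ 0) (τ : R ≃+* R)
    (τ₁ : S ≃+* S) (hcomp : ∀ r, ι (τ r) = τ₁ (ι r)) {r : R} {e : S} (he : ι r = e * ι t)
    {u : R} (hu : τ r = u * r) {v : Rˣ} (hv : τ t = v * t) (huv : IsUnit (u - v)) :
    τ₁ e - e = (ι (u * ↑v⁻¹) - 1) * e ∧ IsUnit (ι (u * ↑v⁻¹) - 1) := by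
  refine ⟨by rw [apply_ratio_eq_mul ι ht τ τ₁ hcomp he hu hv]; ring, ?_⟩
  have h1 : u * ↑v⁻¹ - 1 = (u - v) * ↑v⁻¹ := by
    rw [sub_mul, Units.mul_inv]
  have h2 : IsUnit (u * ↑v⁻¹ - 1) := by
    rw [h1]
    exact huv.mul (Units.isUnit v⁻¹)
  have h3 : ι (u * ↑v⁻¹) - 1 = ι (u * ↑v⁻¹ - 1) := by rw [map_sub, map_one]
  rw [h3]
  exact h2.map ι

end Summit.ResolutionOfSingularities.ResolutionOfSingularities.Theorems.WildQuotientResolution.TameMoveEigen
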